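import Literature.RingTheory.HilbertSamuel.Multiplicity
import Literature.RingTheory.HilbertSamuel.TangentConeDimension
import Literature.RingTheory.HilbertSamuel.Quotient
import Mathlib.RingTheory.Artinian.Ring
import HarnessLib

/-!
# The multiplicity of a Noetherian local ring is well defined, positive, and `= ℓ(A)` in dimension `0`
# (Matsumura, *Commutative Ring Theory*, §14, Formulas 14.1–14.2)

Topic: `Literature/RingTheory/HilbertSamuel`.  `Multiplicity.lean` types Matsumura's multiplicity `e(A) = e(𝔪, A)` of a local
ring as `samuelMultiplicity A`, the eventual value of the `d`-th forward difference (`d = dim A`) of the Samuel function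
`χ(n) = ℓ(A/𝔪^{n+1}) = H^{(1)}_A(n)`, read off with `limUnder`.  This file proves that for a NOETHERIAN local ring that
difference IS eventually constant, so the definition never takes a junk value, and records Matsumura's first two
formulas:

* `exists_forall_le_fwdDiff_iter_eq_samuelMultiplicity` — **`Δ^d χ(n) = e(A)` for all large `n`** (`d = dim A`): Matsumura
  §14, «`χ^q_M(n) = (e/d!) n^d + (terms of lower order)` … with `e ∈ ℤ`», from Thm. 13.4 (the tree's
  `exists_hilbertPolynomial_hilbertFun`: `H^{(0)}_A` is a polynomial of degree `d − 1` for large `n`, `d ≥ 1`; and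
  `hilbertFun_eventually_zero_of_ringKrullDim_eq_zero` for `d = 0`) and Mathlib's `Polynomial.fwdDiff_iter_degree_eq_factorial`;
* `samuelMultiplicity_pos` — **Formula 14.2**: `e(A) > 0` (here `dim M = dim A` as `M = A`; for `d ≥ 1` from the leading
  coefficient `≥ 1/(d−1)!`, for `d = 0` because `e(A) = ℓ(A) ≥ 1`);
* `samuelMultiplicity_eq_length_of_ringKrullDim_eq_zero` — **Formula 14.1, `d = 0`**: «if `d = 0` then `e(q, M) = ℓ(M)`»:
  `(e(A) : ℕ∞) = ℓ_A(A)` for an Artinian local ring;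
* `samuelMultiplicity_eq_of_ringEquiv` — isomorphic Noetherian local rings have the same multiplicity (the Samuel function and the
  dimension are invariants; tree `hilbertFun_eq_of_ringEquiv`, Mathlib `ringKrullDim_eq_of_ringEquiv`).

## Sources

* H. Matsumura, *Commutative Ring Theory* (CUP 1986/1989), §14 (definition of `e(q, M)`; Formula 14.1; Formula 14.2),
  Thm. 13.4. [Matsumura1987]
-/

noncomputable section

open IsLocalRing Filter Finset
open scoped fwdDiff

namespace Literature.RingTheory.HilbertSamuel

universe u

/-! ## Forward-difference bookkeeping (private) -/

section FwdDiff

variable {G : Type*} [AddCommGroup G]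

/-- `Δ^k f (y)` only depends on `f` on `[y, ∞)`. [folklore] -/
private theorem fwdDiff_iter_congr_of_le {f g : ℕ → G} {N : ℕ} (h : ∀ x, N ≤ x → f x = g x) (k : ℕ)
    {y : ℕ} (hy : N ≤ y) : Δ_[1]^[k] f y = Δ_[1]^[k] g y := by
  rw [fwdDiff_iter_eq_sum_shift, fwdDiff_iter_eq_sum_shift]
  refine Finset.sum_congr rfl fun j _ => ?_
  rw [h (y + j • 1) (le_trans hy (Nat.le_add_right _ _))]

/-- Casting `ℤ → ℚ` commutes with `Δ^k`. [folklore] -/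
private theorem intCast_fwdDiff_iter (f : ℕ → ℤ) (k y : ℕ) :
    ((Δ_[1]^[k] f y : ℤ) : ℚ) = Δ_[1]^[k] (fun x => (f x : ℚ)) y := by
  rw [fwdDiff_iter_eq_sum_shift, fwdDiff_iter_eq_sum_shift, Int.cast_sum]
  refine Finset.sum_congr rfl fun j _ => ?_
  rw [smul_eq_mul, zsmul_eq_mul]
  push_cast
  ring

/-- `Δ^k` over `ℕ` of a function of a rational variable is `Δ^k` over `ℚ` at the cast point. [folklore] -/
private theorem fwdDiff_iter_natCast (f : ℚ → ℚ) (k : ℕ) :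
    ∀ y : ℕ, Δ_[1]^[k] (fun x : ℕ => f x) y = Δ_[1]^[k] f (y : ℚ) := by
  induction k with
  | zero => intro y; rfl
  | succ k ih =>
    intro y
    rw [Function.iterate_succ_apply', Function.iterate_succ_apply', fwdDiff, fwdDiff, ih, ih,
      Nat.cast_add, Nat.cast_one]

/-- `Δ^{k+1} f (y) = Δ^k (Δ f) (y)` with `Δ f (x) = f (x+1) − f x`. [folklore] -/
private theorem fwdDiff_iter_succ_apply (f : ℕ → G) (k y : ℕ) :
    Δ_[1]^[k + 1] f y = Δ_[1]^[k] (fun x => f (x + 1) - f x) y := by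
  rw [Function.iterate_succ_apply]
  rfl

end FwdDiff

/-! ## The Samuel function of a Noetherian local ring -/

section Noetherian

variable {A : Type u} [CommRing A] [IsLocalRing A] [IsNoetherianRing A]

omit [IsNoetherianRing A] in
/-- `χ(n+1) − χ(n) = H^{(0)}_A(n+1)` (the Samuel function is the partial sum of the Hilbert function).
[cite: Matsumura1987, §14 (χ(n+1) − χ(n)); CossartJannsenSaito2020, §2.2 (H^{(1)} = Σ H^{(0)})] -/
theorem hilbertSamuelFun_one_succ_sub (n : ℕ) :
    (hilbertSamuelFun A 1 (n + 1) : ℤ) - (hilbertSamuelFun A 1 n : ℤ) = (hilbertFun A (n + 1) : ℤ) := by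
  rw [hilbertSamuelFun, iterPSum_one, psum_succ]
  push_cast
  ring

omit [IsNoetherianRing A] in
/-- With the Hilbert polynomial `P` (degree `b`, `H^{(0)}_A(t) = P(t)` for `t ≥ t₀`):
`Δ^{b+1} χ (n) = Δ^b H^{(0)} (n+1) = lc(P) · b!` for `n + 1 ≥ t₀`. [cite: Matsumura1987, §14 (χ(n) = (e/d!) n^d + …) and Thm. 13.4] -/
private theorem intCast_fwdDiff_iter_succ_hilbertSamuelFun {b t₀ : ℕ} {P : Polynomial ℚ}
    (hP : ∀ t : ℕ, t₀ ≤ t → (hilbertFun A t : ℚ) = P.eval (t : ℚ)) (hdeg : P.natDegree = b)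
    (n : ℕ) (hn : t₀ ≤ n + 1) :
    ((Δ_[1]^[b + 1] (fun n : ℕ => (hilbertSamuelFun A 1 n : ℤ)) n : ℤ) : ℚ) =
      P.leadingCoeff * (b.factorial : ℚ) := by
  rw [intCast_fwdDiff_iter, fwdDiff_iter_succ_apply]
  have hfun : (fun x : ℕ => (((hilbertSamuelFun A 1 (x + 1) : ℤ) : ℚ)) - ((hilbertSamuelFun A 1 x : ℤ) : ℚ)) =
      fun x : ℕ => (hilbertFun A (x + 1) : ℚ) := by
    funext x
    have h := congrArg (fun z : ℤ => (z : ℚ)) (hilbertSamuelFun_one_succ_sub (A := A) x)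
    simpa only [Int.cast_sub, Int.cast_natCast] using h
  rw [hfun, fwdDiff_iter_comp_add (h := 1) (fun t : ℕ => (hilbertFun A t : ℚ)) 1 b n,
    fwdDiff_iter_congr_of_le (g := fun t : ℕ => P.eval (t : ℚ)) (fun t ht => hP t ht) b hn,
    fwdDiff_iter_natCast (fun x : ℚ => P.eval x) b (n + 1)]
  have h := congrFun (Polynomial.fwdDiff_iter_degree_eq_factorial P) ((n + 1 : ℕ) : ℚ)
  rw [hdeg] at h
  rw [show (fun x : ℚ => P.eval x) = P.eval from rfl, h]
  simp [smul_eq_mul]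

/-- The leading coefficient bound `lc(P) ≥ 1/b!` gives `lc(P) · b! ≥ 1`. [folklore] -/
private theorem one_le_leadingCoeff_mul_factorial {b : ℕ} {P : Polynomial ℚ}
    (hlc : ((b.factorial : ℕ) : ℚ)⁻¹ ≤ P.leadingCoeff) : (1 : ℚ) ≤ P.leadingCoeff * (b.factorial : ℚ) := by
  have hb : (0 : ℚ) < (b.factorial : ℚ) := by exact_mod_cast Nat.factorial_pos b
  have h := mul_le_mul_of_nonneg_right hlc hb.le
  rwa [inv_mul_cancel₀ hb.ne'] at h

/-- **`e(A)` is well defined for a Noetherian local ring** (Matsumura §14 with Thm. 13.4: `χ(n) = (e/d!) n^d + …` for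
`n ≫ 0`, `e ∈ ℤ`): with `d = dim A`, the `d`-th forward difference of `n ↦ ℓ(A/𝔪^{n+1})` equals `samuelMultiplicity A` for
all large `n` (so `limUnder` in the definition takes no junk value). [cite: Matsumura1987, §14 (e(q, M) ∈ ℤ) and Thm. 13.4] -/
theorem exists_forall_le_fwdDiff_iter_eq_samuelMultiplicity {d : ℕ} (hd : ringKrullDim A = d) :
    ∃ N : ℕ, ∀ n : ℕ, N ≤ n →
      Δ_[1]^[d] (fun n : ℕ => (hilbertSamuelFun A 1 n : ℤ)) n = (samuelMultiplicity A : ℤ) := by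
  -- it suffices to find an eventual NATURAL value `e`; then `samuelMultiplicity A = e`
  suffices h : ∃ (e : ℕ) (N : ℕ), ∀ n : ℕ, N ≤ n →
      Δ_[1]^[d] (fun n : ℕ => (hilbertSamuelFun A 1 n : ℤ)) n = e by
    obtain ⟨e, N, hN⟩ := h
    exact ⟨N, fun n hn => by rw [hN n hn, samuelMultiplicity_eq_of_forall_le hd hN]⟩
  rcases Nat.eq_zero_or_pos d with rfl | hd1
  · -- `d = 0`: `H^{(0)}` vanishes eventually, so `χ` is eventually constant
    obtain ⟨t₀, ht₀⟩ := hilbertFun_eventually_zero_of_ringKrullDim_eq_zero hd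
    refine ⟨hilbertSamuelFun A 1 t₀, t₀, fun n hn => ?_⟩
    simp only [Function.iterate_zero, id_eq, Nat.cast_inj]
    induction n with
    | zero =>
      have h0 : t₀ = 0 := Nat.le_zero.mp hn
      rw [h0]
    | succ n ih =>
      rcases Nat.lt_or_ge n t₀ with hlt | hge
      · have h : t₀ = n + 1 := by omega
        rw [h]
      · have hstep := hilbertSamuelFun_one_succ_sub (A := A) n
        rw [ht₀ (n + 1) (by omega), Nat.cast_zero, sub_eq_zero] at hstep
        have h' : hilbertSamuelFun A 1 (n + 1) = hilbertSamuelFun A 1 n := by exact_mod_cast hstep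
        rw [h', ih hge]
  · -- `d = b + 1 ≥ 1`: the Hilbert polynomial
    obtain ⟨b, rfl⟩ : ∃ b, d = b + 1 := ⟨d - 1, by omega⟩
    obtain ⟨P, t₀, hP, hdeg, hlc⟩ := exists_hilbertPolynomial_hilbertFun hd hd1
    simp only [Nat.add_sub_cancel] at hdeg hlc
    have hχ := intCast_fwdDiff_iter_succ_hilbertSamuelFun (A := A) hP hdeg
    have hc1 := one_le_leadingCoeff_mul_factorial hlc
    set e : ℤ := Δ_[1]^[b + 1] (fun n : ℕ => (hilbertSamuelFun A 1 n : ℤ)) t₀ with he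
    have hecast : (e : ℚ) = P.leadingCoeff * (b.factorial : ℚ) := hχ t₀ (Nat.le_succ t₀)
    have he0 : 0 ≤ e := by
      have h : (0 : ℚ) ≤ (e : ℚ) := by rw [hecast]; linarith
      exact_mod_cast h
    refine ⟨e.toNat, t₀, fun n hn => ?_⟩
    rw [Int.toNat_of_nonneg he0]
    have h : ((Δ_[1]^[b + 1] (fun n : ℕ => (hilbertSamuelFun A 1 n : ℤ)) n : ℤ) : ℚ) = (e : ℚ) := by
      rw [hecast]
      exact hχ n (by omega)
    exact_mod_cast h

/-- **Formula 14.2 (for `M = A`): `e(A) > 0`** for a Noetherian local ring.  For `dim A = d ≥ 1` the Hilbert polynomial has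
leading coefficient `≥ 1/(d−1)!` (tree `exists_hilbertPolynomial_hilbertFun`), so `Δ^d χ = (d−1)! · lc ≥ 1`; for `d = 0`,
`e(A) = χ(n) = ℓ(A/𝔪^{n+1}) ≥ 1` for large `n`. [cite: Matsumura1987, §14 Formula 14.2] -/
theorem samuelMultiplicity_pos : 0 < samuelMultiplicity A := by
  obtain ⟨d, hd⟩ : ∃ d : ℕ, ringKrullDim A = d := by
    have h1 : ringKrullDim A ≠ ⊥ := ringKrullDim_ne_bot
    have h2 : ringKrullDim A ≠ ⊤ := ringKrullDim_ne_top
    obtain ⟨a, ha⟩ := WithBot.ne_bot_iff_exists.mp h1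
    have ha' : a ≠ ⊤ := fun h => h2 (by rw [← ha, h]; rfl)
    obtain ⟨m, rfl⟩ := WithTop.ne_top_iff_exists.mp ha'
    exact ⟨m, ha.symm⟩
  obtain ⟨N, hN⟩ := exists_forall_le_fwdDiff_iter_eq_samuelMultiplicity hd
  rcases Nat.eq_zero_or_pos d with rfl | hd1
  · -- `d = 0`: `e(A) = χ(N) = Σ_{i ≤ N} H^{(0)}(i) ≥ H^{(0)}(0) = 1`
    have h := hN N le_rfl
    simp only [Function.iterate_zero, id_eq, Nat.cast_inj] at h
    rw [← h, hilbertSamuelFun, iterPSum_one, psum_apply]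
    have h0 : hilbertFun A 0 = 1 := hilbertFun_zero A
    calc 0 < hilbertFun A 0 := by rw [h0]; exact Nat.one_pos
      _ ≤ ∑ i ∈ range (N + 1), hilbertFun A i :=
          Finset.single_le_sum (fun i _ => Nat.zero_le _) (Finset.mem_range.mpr (Nat.succ_pos N))
  · obtain ⟨b, rfl⟩ : ∃ b, d = b + 1 := ⟨d - 1, by omega⟩
    obtain ⟨P, t₀, hP, hdeg, hlc⟩ := exists_hilbertPolynomial_hilbertFun hd hd1
    simp only [Nat.add_sub_cancel] at hdeg hlc
    -- evaluate the spec at `n = max N t₀` and compare with `lc · b! ≥ 1` (recomputed as in the proof above)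
    set n := max N t₀ with hn
    have h1 := hN n (le_max_left _ _)
    have hcast := intCast_fwdDiff_iter_succ_hilbertSamuelFun (A := A) hP hdeg n
      (le_trans (le_max_right _ _) (Nat.le_succ n))
    have hc1 := one_le_leadingCoeff_mul_factorial hlc
    rw [h1] at hcast
    have h2 : (1 : ℚ) ≤ ((samuelMultiplicity A : ℤ) : ℚ) := by rw [hcast]; exact hc1
    have h3 : (1 : ℚ) ≤ (samuelMultiplicity A : ℚ) := by exact_mod_cast h2
    exact_mod_cast (show (0 : ℚ) < samuelMultiplicity A by linarith)

/-- **Formula 14.1, `d = 0`: `e(A) = ℓ(A)`** — for a Noetherian local ring of dimension `0` (an Artinian local ring) the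
multiplicity is the length: `χ(n) = ℓ(A/𝔪^{n+1}) = ℓ(A)` as soon as `𝔪^{n+1} = 0`.
[cite: Matsumura1987, §14 Formula 14.1 ("if d = 0 then e(q, M) = l(M)")] -/
theorem samuelMultiplicity_eq_length_of_ringKrullDim_eq_zero (hd : ringKrullDim A = 0) :
    (samuelMultiplicity A : ℕ∞) = Module.length A A := by
  obtain ⟨N, hN⟩ := exists_forall_le_fwdDiff_iter_eq_samuelMultiplicity (d := 0) (by exact_mod_cast hd)
  -- `𝔪` is nilpotent
  haveI : Ring.KrullDimLE 0 A := Ring.krullDimLE_iff.mpr (by rw [hd]; rfl)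
  haveI : IsArtinianRing A := IsNoetherianRing.isArtinianRing_of_krullDimLE_zero
  obtain ⟨M, hM⟩ := IsArtinianRing.isNilpotent_jacobson_bot (R := A)
  rw [IsLocalRing.jacobson_eq_maximalIdeal ⊥ bot_ne_top] at hM
  set n := max N M with hn
  have h := hN n (le_max_left _ _)
  simp only [Function.iterate_zero, id_eq, Nat.cast_inj] at h
  rw [← h, hilbertSamuelFun_one_eq_length]
  have hzero : maximalIdeal A ^ (n + 1) = ⊥ := by
    rw [eq_bot_iff, ← Ideal.zero_eq_bot, ← hM]
    exact Ideal.pow_le_pow_right (le_trans (le_max_right _ _) (Nat.le_succ n))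
  exact (Submodule.quotEquivOfEqBot _ hzero).length_eq

/-- **Isomorphic (Noetherian) local rings have the same multiplicity**: `e(A)` only depends on the Samuel function
`n ↦ ℓ(A/𝔪^{n+1})` and on `dim A`, both invariant under ring isomorphisms. [cite: Matsumura1987, §14 (definition of e(A) = e(𝔪, A))] -/
theorem samuelMultiplicity_eq_of_ringEquiv {B : Type u} [CommRing B] [IsLocalRing B] (e : A ≃+* B) :
    samuelMultiplicity A = samuelMultiplicity B := by
  have hH : hilbertFun A = hilbertFun B := hilbertFun_eq_of_ringEquiv e
  have hd : ringKrullDim A = ringKrullDim B := ringKrullDim_eq_of_ringEquiv e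
  unfold samuelMultiplicity
  rw [hd]
  have hfun : (fun n : ℕ => (hilbertSamuelFun A 1 n : ℤ)) = fun n : ℕ => (hilbertSamuelFun B 1 n : ℤ) := by
    funext n
    rw [hilbertSamuelFun, hilbertSamuelFun, hH]
  rw [hfun]

end Noetherian

end Literature.RingTheory.HilbertSamuel

end
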